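import Summits.BirchSwinnertonDyer.BirchSwinnertonDyer.Theorems.ClassRecordThreeEulerHalvesAtThreeShimuraInertSavingBudgetSetAnchor
import Summits.BirchSwinnertonDyer.BirchSwinnertonDyer.Theorems.ClassRecordThreeEulerHalvesAtThreeShimuraInertSavingBudgetSetTwinLowerD
import Summits.BirchSwinnertonDyer.BirchSwinnertonDyer.Theorems.ClassRecordThreeEulerHalvesAtThreeTwinLowerSupplyExtraSet
import Summits.BirchSwinnertonDyer.BirchSwinnertonDyer.Theorems.ClassRecordThreeEulerHalvesAtThreeCoStepLDefs
import HarnessLib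

/-!
# Route `ClassRecordThree` (rung K2@3), crux 5 `EulerHalvesAtThree` (item stmt-BirchSwinnertonDyer-19109, routes `ClassRecordThree` ∕
# `KolyvaginRoadThree`): bsd-idea-10's CARTAN BOOKKEEPING KERNEL, configuration (A1) («saving-servable off `C`»), BOTH SIDES, at `p = 3`
# (cell `bsd-stepL`, seat `bsd-stepL-tam3-p1` g19, LINE OWNER of 19109; `--supports stmt-BirchSwinnertonDyer-19109 --as helper`)

WHY. `Cruxes/EulerHalvesAtThree/Lines/cartan.lean` §C2 (bsd-idea-10 g7; unregistered, idea-crit-14 V57 PASS-WITH-PRICE) registers — for an adopting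
lead — the PORT stub `stub_cartanKernelAtThree`: from the Cartan SAVED display (`stub_cartanSavingDisplayAtThree`), (F4) (Friedberg–Hoffstein with
`S ∪ C` inert), (F5) (the local Tamagawa facts at a Cartan place), the X11a lower half ∕ TL₃ and the named print, conclude
`∀ W, ClassX11b W 3 → Surj W 3 → Three.CartanServableAtThree W → Typed.MissingUpperBoundAt W 3`. `Three.CartanServableAtThree W` (p659207, the
ideator's text VERBATIM) is a disjunction of three configurations OFF the Cartan set `C`: (M) mono-carrier, (A0) inert-servable, (A1) saving-servable
up to one exempted bad place `q₁ ∉ S ∪ C`. THIS FILE closes configuration (A1) at `p = 3` on BOTH sides from this seat's road-agnostic budget-set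
cores — (ram): p659752 `…_of_inertBudgetSet_oddD_anchor` with Skinner 2016 Thm. C for the twist; ¬(ram): p660279 `…_of_inertBudgetSet_pAnchor_of_twinLowerD`
on the supply p660419 `fhTwinLowerSupplyExtraSet_of_friedbergHoffsteinExtraSet_of_x11aLowerHalf` (X11a lower half for the twist) — consuming the
ideator's display text `stub_cartanSavingDisplayAtThree` VERBATIM (binder `hSavC`), the (F4) text VERBATIM (`hFHC`), and the (F5) content as the two
local binders `hbudget` (`ord₃ c_q(E) + ord₃ c_q(E^{d_K}) ≤ 1`) and `hCtwist` (the twist is not multiplicative at `q ∈ C`). Configurations (M)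
(modular Cartan curve, `S = ∅`, `3` split in `K`) and (A0) (no exempted place) are the remaining ports of the same template.

HONEST FRAMING: theorems only (no definition, no named fact, no `sorry`); CONDITIONAL on every displayed binder — the Cartan display (OPEN: Kohen–Pacetti
∕ Cai–Shu–Tian ∕ the Cartan degree law K1, open in print), (F4), (F5), `hX11a` (item 19064 at 3), the named print; nothing is asserted about any
curve; no census label moves (T7); item 19109 is NOT closed and none of its registered stubs is proved (the line of record r22 does not contain the
Cartan road; this serves the r23-cartan OPTION). BSD is proved for no curve. Credit: bsd-idea-10 g5–g8.
References: [KohenPacetti2016] Prop. 3.4, Thm. 3.6, Thm. 3.7, Rem. 3.8; [CaiShuTian2014] Thm. 1.5 sc. 1, Prop. 3.8; [PastenShimura2024] Prop. 6.13,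
Lemma 6.18, Thm. 6.19 (ii); [Jetchev2008] Thm. 1.1; [Skinner2016PacificMC] Thm. C; [FriedbergHoffstein1995] Thm. B; [SilvermanATAEC1994] IV.9.4.
-/

noncomputable section

open scoped Classical

open WeierstrassCurve NumberField IsDedekindDomain Literature.NumberTheory.EllipticCurves
  Rat.HeightOneSpectrum CongruenceSubgroup
  Literature.NumberTheory.EllipticCurves.ModularForms
  Literature.NumberTheory.EllipticCurves.Rank1Residual
  Literature.NumberTheory.EllipticCurves.Rank1Residual.Typed
  Literature.NumberTheory.QuadraticFields.Quadratic
  Literature.NumberTheory.EllipticCurves.BarriosEtAl2025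
  Literature.NumberTheory.Automorphic
  Summit.BirchSwinnertonDyer.Rank1Residual
  Summit.BirchSwinnertonDyer.Rank1Residual.X11b

-- the cell's Theorems namespace repeats the summit name (Summit.<Summit>.<Problem>), as in every sibling file
set_option linter.dupNamespace false

namespace Summit.BirchSwinnertonDyer.BirchSwinnertonDyer.Theorems.CartanKernel

section
variable
  -- named print
  (hSk : Skinner2016.thmC_padicValRat_bsd_rank_zero)
  (hGZK : rank_eq_analyticRank_of_analyticRank_le_one) (hmod : hasEntireLFunction_rat)
  (hnf : exists_isNewformOf) (hMaz : mazur_not_dvd_maninConstant_of_odd)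
  (hBR : localTamagawaNumber_quadraticTwist_two_mem_of_goodReduction)
  (hJL : nonempty_shimuraParametrizationData) (hCO : PastenShimura2024_componentOrders)
  -- (F4): Friedberg–Hoffstein with inertness at `S ∪ C` (bsd-idea-10's `friedbergHoffstein_exists_twist_ne_zero_inertAt_sq`, VERBATIM)
  (hFHC : ∀ (W : WeierstrassCurve ℚ) [W.IsElliptic], W.rootNumber = -1 →
    ∀ (S C : Finset ℕ), (∀ ℓ ∈ S, ∃ _ : Fact ℓ.Prime, W.HasMultiplicativeReductionAtPrime ℓ) →
      Even S.card →
      (∀ q ∈ C, ∃ _ : Fact q.Prime, q ^ 2 ∣ W.conductorNorm ℤ ∧ ¬ q ^ 3 ∣ W.conductorNorm ℤ) →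
    ∀ B : ℕ, ∃ (K : Type) (_ : Field K) (_ : NumberField K),
      IsImaginaryQuadratic K ∧ B < (NumberField.discr K).natAbs ∧
        (∀ ℓ ∈ S ∪ C, ((Ideal.span {(ℓ : ℤ)}).primesOver (𝓞 K)).ncard = 1 ∧
          ¬ (ℓ : ℤ) ∣ NumberField.discr K) ∧
        (∀ ℓ : ℕ, ℓ.Prime → ℓ ∣ W.conductorNorm ℤ → ℓ ∉ S → ℓ ∉ C →
          ((Ideal.span {(ℓ : ℤ)}).primesOver (𝓞 K)).ncard = 2) ∧
        (W.quadraticTwist (NumberField.discr K : ℚ)).entireLFunction 1 ≠ 0)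
  -- the X11a lower half at `3` (item 19064 read at `3`; the registered `stub_x11aLowerHalfAtThree` text)
  (hX11a : ∀ (V : WeierstrassCurve ℚ) [V.IsElliptic] [V.IsGloballyMinimal],
    Summit.BirchSwinnertonDyer.Rank1Residual.ClassX11a V 3 → Typed.MissingLowerBoundAt V 3)
  -- bsd-idea-10's Cartan SAVED display, `stub_cartanSavingDisplayAtThree` VERBATIM
  (hSavC : ∀ (V : WeierstrassCurve ℚ) [V.IsElliptic] [V.IsGloballyMinimal], ClassX11b V 3 → Surj V 3 →
    ∀ (N : ℕ) [NeZero N] (K : Type) [Field K] [NumberField K] (S C : Finset ℕ)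
    (Dt : ModularParametrizationData V N)
    (X : ShimuraCurveData (∏ q ∈ S, q) (N / ∏ q ∈ S, q))
    (W' : WeierstrassCurve ℚ) [W'.IsElliptic] (P₀ : ShimuraParametrizationData X W'),
    V.conductorNorm ℤ = N → IsImaginaryQuadratic K → NumberField.discr K < -4 → Even S.card →
    (∀ ℓ ∈ S, ℓ.Prime ∧ ℓ ∣ N ∧ ¬ ℓ ^ 2 ∣ N ∧
      ((Ideal.span {(ℓ : ℤ)}).primesOver (𝓞 K)).ncard = 1 ∧ ¬ (ℓ : ℤ) ∣ NumberField.discr K) →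
    (∀ q ∈ C, ∃ _ : Fact q.Prime, q ≠ 3 ∧ q ^ 2 ∣ N ∧ ¬ q ^ 3 ∣ N ∧
      3 ∣ (V.baseChange ℚ_[q]).localTamagawaNumber ℤ_[q] ∧
      ((Ideal.span {(q : ℤ)}).primesOver (𝓞 K)).ncard = 1 ∧ ¬ (q : ℤ) ∣ NumberField.discr K) →
    (∀ ℓ : ℕ, ℓ.Prime → ℓ ∣ N → ℓ ∉ S → ℓ ∉ C → ((Ideal.span {(ℓ : ℤ)}).primesOver (𝓞 K)).ncard = 2) →
    ¬ (3 : ℤ) ∣ Dt.c → P₀.IsMinimalFor V →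
    ∃ (P : (V.baseChange K).toAffine.Point) (degC : ℕ), 0 < degC ∧
      padicValNat 3 degC + C.card = padicValNat 3 P₀.deg ∧
      LDerivEK V K =
        8 * (Real.pi : ℂ) ^ 2 * peterssonProduct (Gamma0 N) 2 Dt.f Dt.f /
            ((((Units.torsionOrder K : ℝ) / 2) ^ 2 * √|(NumberField.discr K : ℝ)| : ℝ) : ℂ) *
          ((P.canonicalHeight : ℂ) / (degC : ℂ)) ∧
      (¬ IsOfFinAddOrder P → ∀ (q : ℕ) [Fact q.Prime] (s : ℕ), q ∉ S → q ∉ C →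
        s ≤ padicValNat 3 ((V.baseChange ℚ_[q]).localTamagawaNumber ℤ_[q]) →
        padicValNat 3 (Nat.card (AddCommGroup.primaryComponent (V.baseChange K).sha 3)) + 2 * s ≤
          2 * padicValNat 3 (AddSubgroup.zmultiples P).index))

include hSk hGZK hmod hnf hMaz hBR hJL hCO hFHC hX11a hSavC in
/-- **Configuration (A1) off `C`, BOTH sides, at `p = 3`**: for `W` in X11b@3 with `Surj W 3` (hence `E[3]` irreducible), a finite set `C` of
CARTAN-type places (`q ≠ 3`, `q² ∥ N`, `3 ∣ c_q(E)`) with the (F5)-type local binders `hbudget` ∕ `hCtwist`, ONE exempted bad place `q₁ ∉ S ∪ C`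
with the Tamagawa SHAPE off `q₁` and `C`, an even multiplicative `S ∋ 3` missing `q₁` with every offending split prime inside — bsd-idea-10's third
disjunct of `Three.CartanServableAtThree W` with its Cartan set `C` displayed —: `Typed.MissingUpperBoundAt W 3`. (ram) pairs go through p659752
(Skinner 2016 Thm. C for the twist at the (F4)-frame), ¬(ram) pairs through p660279 on the supply p660419 (the X11a lower half at the twist).
CONDITIONAL on every binder; nothing booked. [cite: KohenPacetti2016, Thm. 3.6, Thm. 3.7, Rem. 3.8 (shape; nothing asserted)]
[cite: Jetchev2008, Thm. 1.1 (p. 812)] [cite: Skinner2016PacificMC, Thm. C (§1)] [cite: FriedbergHoffstein1995, Thm. B] [cite: PastenShimura2024, Lemma 6.18, Thm. 6.19 (ii)] -/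
theorem missingUpperBoundAt_three_of_classX11b_of_surj_of_savingServableOffCartanSet
    (W : WeierstrassCurve ℚ) [W.IsElliptic] [W.IsGloballyMinimal] (hX : ClassX11b W 3) (hsurj : Surj W 3)
    (C : Finset ℕ)
    (hCdata : ∀ q ∈ C, ∃ _ : Fact q.Prime, q ≠ 3 ∧ q ^ 2 ∣ W.conductorNorm ℤ ∧ ¬ q ^ 3 ∣ W.conductorNorm ℤ ∧
      3 ∣ (W.baseChange ℚ_[q]).localTamagawaNumber ℤ_[q])
    (hbudget : ∀ (K : Type) [Field K] [NumberField K], IsImaginaryQuadratic K →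
      (∀ q ∈ C, ((Ideal.span {(q : ℤ)}).primesOver (𝓞 K)).ncard = 1 ∧ ¬ (q : ℤ) ∣ NumberField.discr K) →
      ∀ (Cd : VariableChange ℚ) (Wd : WeierstrassCurve ℚ) [Wd.IsElliptic] [Wd.IsGloballyMinimal],
        Cd • W.quadraticTwist (NumberField.discr K : ℚ) = Wd →
        ∀ (q : ℕ) [Fact q.Prime], q ∈ C →
          padicValNat 3 ((W.baseChange ℚ_[q]).localTamagawaNumber ℤ_[q]) +
            padicValNat 3 ((Wd.baseChange ℚ_[q]).localTamagawaNumber ℤ_[q]) ≤ 1)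
    (hCtwist : ∀ (K : Type) [Field K] [NumberField K], IsImaginaryQuadratic K →
      (∀ q ∈ C, ((Ideal.span {(q : ℤ)}).primesOver (𝓞 K)).ncard = 1 ∧ ¬ (q : ℤ) ∣ NumberField.discr K) →
      ∀ (Cd : VariableChange ℚ) (Wd : WeierstrassCurve ℚ) [Wd.IsElliptic] [Wd.IsGloballyMinimal],
        Cd • W.quadraticTwist (NumberField.discr K : ℚ) = Wd →
        ∀ (q : ℕ) [Fact q.Prime], q ∈ C → ¬ Wd.HasMultiplicativeReductionAtPrime q)
    -- configuration (A1) off `C` (the third disjunct of `Three.CartanServableAtThree W`, its `C` displayed)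
    (q₁ : ℕ) [Fact q₁.Prime] (hbad₁ : ¬ W.HasGoodReductionAtPrime q₁) (hq₁C : q₁ ∉ C)
    (hshape : ∀ (q : ℕ) [Fact q.Prime], q ≠ q₁ → q ∉ C → 3 ∣ (W.baseChange ℚ_[q]).localTamagawaNumber ℤ_[q] →
      W.HasSplitMultiplicativeReductionAtPrime q)
    (S : Finset ℕ) (hSmult : ∀ ℓ ∈ S, ∃ _ : Fact ℓ.Prime, Mult W ℓ) (hSeven : Even S.card)
    (h3S : 3 ∈ S) (hq₁S : q₁ ∉ S)
    (hFC : ∀ (ℓ : ℕ) [Fact ℓ.Prime], ℓ ∉ S → ℓ ≠ q₁ → W.HasSplitMultiplicativeReductionAtPrime ℓ →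
      ¬ 3 ∣ padicValInt ℓ W.minimalDiscriminantInt) :
    Typed.MissingUpperBoundAt W 3 := by
  haveI : Fact (Nat.Prime 3) := ⟨Nat.prime_three⟩
  -- the display at the pair, with `3 ∈ S` dropped from the premises (the ideator's display holds at every even `S`)
  have hHKs := fun (N : ℕ) (_ : NeZero N) (K : Type) (_ : Field K) (_ : NumberField K) (S : Finset ℕ)
      (Dt : ModularParametrizationData W N) (X : ShimuraCurveData (∏ q ∈ S, q) (N / ∏ q ∈ S, q))
      (W' : WeierstrassCurve ℚ) (_ : W'.IsElliptic) (P₀ : ShimuraParametrizationData X W')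
      (hN : W.conductorNorm ℤ = N) (hK : IsImaginaryQuadratic K) (hD : NumberField.discr K < -4) (hSe : Even S.card)
      hin hCin hsp (_ : 3 ∈ S) (hc : ¬ (3 : ℤ) ∣ Dt.c) (hP₀ : P₀.IsMinimalFor W) ↦
    hSavC W hX hsurj N K S C Dt X W' P₀ hN hK hD hSe hin hCin hsp hc hP₀
  have hCsq : ∀ q ∈ C, ∃ _ : Fact q.Prime, q ^ 2 ∣ W.conductorNorm ℤ ∧ ¬ q ^ 3 ∣ W.conductorNorm ℤ := by
    intro q hq
    obtain ⟨hqF, -, h2, h3, -⟩ := hCdata q hq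
    exact ⟨hqF, h2, h3⟩
  have hFC' : ∀ (ℓ : ℕ) [Fact ℓ.Prime], ℓ ∉ S → ℓ ≠ q₁ → ℓ ∉ C → W.HasSplitMultiplicativeReductionAtPrime ℓ →
      ¬ 3 ∣ padicValInt ℓ W.minimalDiscriminantInt := fun ℓ _ hS h1 _ hs ↦ hFC ℓ hS h1 hs
  by_cases hram : Ram W 3
  · -- (ram): Skinner 2016 Thm. C for the twist at the (F4)-frame
    obtain ⟨ℓ₀, hℓ₀F, hℓ₀3, hmult₀, hram₀⟩ := hram
    haveI := hℓ₀F
    exact missingUpperBoundAt_of_classX11b_of_ram_of_inertSet_of_extraPlace_of_inertBudgetSet_oddD_anchor hSk hGZK hmod hnf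
      hFHC hMaz hBR hJL hCO W 3 hX hℓ₀3 hmult₀ hram₀ q₁ hbad₁ C hq₁C hCdata hbudget hshape hHKs S hSmult hSeven h3S hq₁S hFC'
  · -- ¬(ram): the twin-lower SUPPLY with `S ∪ C` inert from (F4) + the X11a lower half at the twist
    exact missingUpperBoundAt_of_classX11b_of_inertSet_of_extraPlace_of_inertBudgetSet_pAnchor_of_twinLowerD hGZK hmod hnf hMaz
      hBR hJL hCO W 3 hX q₁ hbad₁ C hq₁C hCdata hbudget hshape hHKs
      (fhTwinLowerSupplyExtraSet_of_friedbergHoffsteinExtraSet_of_x11aLowerHalf hGZK hmod hnf hFHC W 3 hX hram C hCsq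
        hCtwist hX11a)
      S hSmult hSeven h3S hq₁S hFC'

end

end Summit.BirchSwinnertonDyer.BirchSwinnertonDyer.Theorems.CartanKernel

end
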